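import Summits.Ventures.QEC.Census.CertBZInfoSets
import Summits.Ventures.QEC.Census.BB.BB144.BZData
import HarnessLib

/-!
# `BB144` — `bz` certificate, side Z: relative-rank BOUNDS per block, tier KERNEL (item S7.BZI; qec-search-7)

For each block `b`: `cert.bzZBound bzData b = true` by `decide +kernel` — the Brouwer–Zimmermann bound
`Σ_i (t_i + 1 − (k_b − relRank_i))`, with the relative ranks RECOUNTED from the information-set masks
(`bzBoundList`), reaches `wEff + 1` (CERT-FORMAT C3 / C17 (6); the `hbound` input of `BZAssembly.forall_lt_of_bz`).
-/

namespace Summit.Ventures.QEC.Census.BB144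

/-- Block 0: bound 12 ≥ target (kernel). -/
theorem boundZ_0 : cert.bzZBound bzData 0 = true := by decide +kernel

/-- Block 1: bound 12 ≥ target (kernel). -/
theorem boundZ_1 : cert.bzZBound bzData 1 = true := by decide +kernel

/-- Block 2: bound 12 ≥ target (kernel). -/
theorem boundZ_2 : cert.bzZBound bzData 2 = true := by decide +kernel

/-- Block 3: bound 12 ≥ target (kernel). -/
theorem boundZ_3 : cert.bzZBound bzData 3 = true := by decide +kernel

/-- Block 4: bound 12 ≥ target (kernel). -/
theorem boundZ_4 : cert.bzZBound bzData 4 = true := by decide +kernel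

/-- Block 5: bound 12 ≥ target (kernel). -/
theorem boundZ_5 : cert.bzZBound bzData 5 = true := by decide +kernel

/-- Block 6: bound 12 ≥ target (kernel). -/
theorem boundZ_6 : cert.bzZBound bzData 6 = true := by decide +kernel

/-- Block 7: bound 12 ≥ target (kernel). -/
theorem boundZ_7 : cert.bzZBound bzData 7 = true := by decide +kernel

/-- Block 8: bound 12 ≥ target (kernel). -/
theorem boundZ_8 : cert.bzZBound bzData 8 = true := by decide +kernel

/-- Block 9: bound 12 ≥ target (kernel). -/
theorem boundZ_9 : cert.bzZBound bzData 9 = true := by decide +kernel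

/-- Block 10: bound 12 ≥ target (kernel). -/
theorem boundZ_10 : cert.bzZBound bzData 10 = true := by decide +kernel

/-- Block 11: bound 12 ≥ target (kernel). -/
theorem boundZ_11 : cert.bzZBound bzData 11 = true := by decide +kernel

/-- Block 12: bound 12 ≥ target (kernel). -/
theorem boundZ_12 : cert.bzZBound bzData 12 = true := by decide +kernel

/-- Block 13: bound 12 ≥ target (kernel). -/
theorem boundZ_13 : cert.bzZBound bzData 13 = true := by decide +kernel

/-- Block 14: bound 12 ≥ target (kernel). -/
theorem boundZ_14 : cert.bzZBound bzData 14 = true := by decide +kernel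

/-- Block 15: bound 12 ≥ target (kernel). -/
theorem boundZ_15 : cert.bzZBound bzData 15 = true := by decide +kernel

/-- Block 16: bound 12 ≥ target (kernel). -/
theorem boundZ_16 : cert.bzZBound bzData 16 = true := by decide +kernel

/-- Block 17: bound 12 ≥ target (kernel). -/
theorem boundZ_17 : cert.bzZBound bzData 17 = true := by decide +kernel

/-- Block 18: bound 12 ≥ target (kernel). -/
theorem boundZ_18 : cert.bzZBound bzData 18 = true := by decide +kernel

/-- Block 19: bound 12 ≥ target (kernel). -/
theorem boundZ_19 : cert.bzZBound bzData 19 = true := by decide +kernel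

/-- Block 20: bound 12 ≥ target (kernel). -/
theorem boundZ_20 : cert.bzZBound bzData 20 = true := by decide +kernel

/-- Block 21: bound 12 ≥ target (kernel). -/
theorem boundZ_21 : cert.bzZBound bzData 21 = true := by decide +kernel

/-- Block 22: bound 12 ≥ target (kernel). -/
theorem boundZ_22 : cert.bzZBound bzData 22 = true := by decide +kernel

/-- Block 23: bound 12 ≥ target (kernel). -/
theorem boundZ_23 : cert.bzZBound bzData 23 = true := by decide +kernel

/-- Block 24: bound 12 ≥ target (kernel). -/
theorem boundZ_24 : cert.bzZBound bzData 24 = true := by decide +kernel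

/-- Block 25: bound 12 ≥ target (kernel). -/
theorem boundZ_25 : cert.bzZBound bzData 25 = true := by decide +kernel

/-- Block 26: bound 12 ≥ target (kernel). -/
theorem boundZ_26 : cert.bzZBound bzData 26 = true := by decide +kernel

/-- Block 27: bound 12 ≥ target (kernel). -/
theorem boundZ_27 : cert.bzZBound bzData 27 = true := by decide +kernel

/-- Block 28: bound 12 ≥ target (kernel). -/
theorem boundZ_28 : cert.bzZBound bzData 28 = true := by decide +kernel

/-- Block 29: bound 12 ≥ target (kernel). -/
theorem boundZ_29 : cert.bzZBound bzData 29 = true := by decide +kernel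

/-- Block 30: bound 12 ≥ target (kernel). -/
theorem boundZ_30 : cert.bzZBound bzData 30 = true := by decide +kernel

/-- Block 31: bound 12 ≥ target (kernel). -/
theorem boundZ_31 : cert.bzZBound bzData 31 = true := by decide +kernel

/-- Block 32: bound 12 ≥ target (kernel). -/
theorem boundZ_32 : cert.bzZBound bzData 32 = true := by decide +kernel

/-- Block 33: bound 12 ≥ target (kernel). -/
theorem boundZ_33 : cert.bzZBound bzData 33 = true := by decide +kernel

/-- Block 34: bound 12 ≥ target (kernel). -/
theorem boundZ_34 : cert.bzZBound bzData 34 = true := by decide +kernel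

/-- Block 35: bound 12 ≥ target (kernel). -/
theorem boundZ_35 : cert.bzZBound bzData 35 = true := by decide +kernel

/-- Block 36: bound 12 ≥ target (kernel). -/
theorem boundZ_36 : cert.bzZBound bzData 36 = true := by decide +kernel

/-- Block 37: bound 12 ≥ target (kernel). -/
theorem boundZ_37 : cert.bzZBound bzData 37 = true := by decide +kernel

/-- Block 38: bound 12 ≥ target (kernel). -/
theorem boundZ_38 : cert.bzZBound bzData 38 = true := by decide +kernel

/-- Block 39: bound 12 ≥ target (kernel). -/
theorem boundZ_39 : cert.bzZBound bzData 39 = true := by decide +kernel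

/-- Block 40: bound 12 ≥ target (kernel). -/
theorem boundZ_40 : cert.bzZBound bzData 40 = true := by decide +kernel

/-- Block 41: bound 12 ≥ target (kernel). -/
theorem boundZ_41 : cert.bzZBound bzData 41 = true := by decide +kernel

/-- Block 42: bound 12 ≥ target (kernel). -/
theorem boundZ_42 : cert.bzZBound bzData 42 = true := by decide +kernel

/-- Block 43: bound 12 ≥ target (kernel). -/
theorem boundZ_43 : cert.bzZBound bzData 43 = true := by decide +kernel

/-- Block 44: bound 12 ≥ target (kernel). -/
theorem boundZ_44 : cert.bzZBound bzData 44 = true := by decide +kernel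

/-- Block 45: bound 12 ≥ target (kernel). -/
theorem boundZ_45 : cert.bzZBound bzData 45 = true := by decide +kernel

/-- Block 46: bound 12 ≥ target (kernel). -/
theorem boundZ_46 : cert.bzZBound bzData 46 = true := by decide +kernel

/-- Block 47: bound 12 ≥ target (kernel). -/
theorem boundZ_47 : cert.bzZBound bzData 47 = true := by decide +kernel

/-- Block 48: bound 12 ≥ target (kernel). -/
theorem boundZ_48 : cert.bzZBound bzData 48 = true := by decide +kernel

/-- Block 49: bound 12 ≥ target (kernel). -/
theorem boundZ_49 : cert.bzZBound bzData 49 = true := by decide +kernel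

/-- Block 50: bound 12 ≥ target (kernel). -/
theorem boundZ_50 : cert.bzZBound bzData 50 = true := by decide +kernel

/-- Block 51: bound 12 ≥ target (kernel). -/
theorem boundZ_51 : cert.bzZBound bzData 51 = true := by decide +kernel

/-- Block 52: bound 12 ≥ target (kernel). -/
theorem boundZ_52 : cert.bzZBound bzData 52 = true := by decide +kernel

/-- Block 53: bound 12 ≥ target (kernel). -/
theorem boundZ_53 : cert.bzZBound bzData 53 = true := by decide +kernel

/-- Block 54: bound 12 ≥ target (kernel). -/
theorem boundZ_54 : cert.bzZBound bzData 54 = true := by decide +kernel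

/-- Block 55: bound 12 ≥ target (kernel). -/
theorem boundZ_55 : cert.bzZBound bzData 55 = true := by decide +kernel

/-- Block 56: bound 12 ≥ target (kernel). -/
theorem boundZ_56 : cert.bzZBound bzData 56 = true := by decide +kernel

/-- Block 57: bound 12 ≥ target (kernel). -/
theorem boundZ_57 : cert.bzZBound bzData 57 = true := by decide +kernel

/-- Block 58: bound 12 ≥ target (kernel). -/
theorem boundZ_58 : cert.bzZBound bzData 58 = true := by decide +kernel

/-- Block 59: bound 12 ≥ target (kernel). -/
theorem boundZ_59 : cert.bzZBound bzData 59 = true := by decide +kernel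

/-- Block 60: bound 12 ≥ target (kernel). -/
theorem boundZ_60 : cert.bzZBound bzData 60 = true := by decide +kernel

/-- Block 61: bound 12 ≥ target (kernel). -/
theorem boundZ_61 : cert.bzZBound bzData 61 = true := by decide +kernel

/-- Block 62: bound 12 ≥ target (kernel). -/
theorem boundZ_62 : cert.bzZBound bzData 62 = true := by decide +kernel

/-- Block 63: bound 12 ≥ target (kernel). -/
theorem boundZ_63 : cert.bzZBound bzData 63 = true := by decide +kernel

/-- Block 64: bound 12 ≥ target (kernel). -/
theorem boundZ_64 : cert.bzZBound bzData 64 = true := by decide +kernel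

end Summit.Ventures.QEC.Census.BB144
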